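import Summits.Ventures.HSemireg.WedgeHankelRecurrenceHankelPmV
import Summits.Ventures.HSemireg.WedgeHankelRecurrenceHankelSchurRank

/-!
# Venture HSemireg — FROBENIUS' RULE FOR SINGULAR HANKEL FORMS whose rank is carried by a leading minor, and BPR PROP. 9.25 a): over a linearly ordered field, if `det H_{r'}(q) ≠ 0` and
# `rank H_t(q) = r' + 1` (`r' ≤ t`) then **`Sign H_t(q) = PmV(1, det H_0(q), …, det H_t(q))`** (the minors of order `> r' + 1` vanish and are trailing zeros of the count); for `q = dualSeq P Q`,
# `P` monic of degree `≤ t + 1`, `Q` coprime to `P`: **`Sign H_t(Q/P) = PmV(1, han_1, …, han_{t+1}) = Ind(Q/P)`** (over `ℝ`, N152) and, with `Q = P′` for separable `P`, the number of distinct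
# real roots of `P` is `PmV` of the minors of Hermite's form (BPR Remark 9.27 c) «generalizes Remark 4.59»)

HONEST FRAMING. Part of the Lean index of the computation cell `pub-hsemireg` (seat p10 gen 37, Sunday typer «UNIFORM-IN-n»).
LINEAR ALGEBRA OF HANKEL MATRICES OVER A LINEARLY ORDERED FIELD ∕ `ℝ` ONLY (Mathlib's `sigPos` ∕ `sigNeg`, `Matrix.rank`; PROVED Literature `Algebra/Polynomial/CauchyIndex` for `cauchyIndex`): no
variety, no cohomology theory, no sheaf, no Ext group and no semiregularity map is constructed here; nothing here says that HC / HC_CM / HC_AV holds; no Literature fact (unproved `Prop`) is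
declared or used.  Custodian versions as in `WedgeHankelSiegelIdeal` (1/3).
SOURCE OF THE ARGUMENT (cited; held text read, `book:basu2006-algorithms-real-algebraic-geometry` pp. 339–340): S. Basu, R. Pollack, M.-F. Roy, *Algorithms in Real Algebraic Geometry* (2006)
§9.2.2 **Proposition 9.25 a)** «Suppose `p ≤ n`. Then `Sign(Han(s̄_n)) = PmV(han(s̄_{[0..n]})) = PmV(sRes(P,Q)) = Ind(Q/P)`» (for `P`, `Q` coprime, `p = deg P`; then `han(s̄_p) ≠ 0` and `han(s̄_k)
= 0` for `k > p`) and **Remark 9.27 c)** (the invertible case, N170; «This generalizes Remark 4.59» — the real-root count from the principal minors of `Her(P, 1)`); the middle term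
`PmV(sRes(P,Q))` (signed subresultants) is NOT typed (N158 has the non-defective case).
DEDUP DISCLOSURE (`rg` of the whole tree + Mathlib, 2026-09-01): N170 is the invertible case; N174 (`…HankelSchurRank`) the definition-free inertia transfer; N152 `Sign H_t(Q/P) = Ind(Q/P)` for
`t + 1 ≥ deg P`; N158 `Ind = Σ sign(D_k D_{k+1})` in the NON-DEFECTIVE case only; nothing in the tree evaluates `PmV` of Hankel minors with gaps for singular forms — that is this file.
5 names: 0 hits tree-wide.

WHAT IS IN THE TREE (or staged ahead of this file).  N170 (`…HankelPmV`, definition lane): `genPmV`, `genPmVAux_cons ∕ _nil`, `genPmV_cons`, **`sigPos_sub_sigNeg_hankelSq_eq_genPmV`**; N174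
(`…HankelSchurRank`): **`sigPos_sigNeg_hankelSq_eq_of_rank_eq`**, `det_hankelSq_eq_zero_of_rank_le`; N73 `det_hankelSq_dualSeq_ne_zero_iff`; N142 `rank_hankelSq_dualSeq_eq_natDegree_iff_isCoprime_of_le`;
N152 `sigPos_sub_sigNeg_hankelSq_dualSeq_eq_cauchyIndex_of_monic`; N129 `sigPos_sub_sigNeg_hankelSq_dualSeq_derivative_real`.  Mathlib: `List.range_add`, `List.eq_replicate_iff`, `Polynomial.separable_def`.
THIS FILE (namespace `Summit.Ventures.HSemireg.Wedge.HankelOuter` continued; CHAINED on N170 (review lane) + N174; 0 definitions):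
* §815b `genPmVAux_append_replicate_zero` (trailing zeros do not change `PmV`), **`sigPos_sub_sigNeg_hankelSq_eq_genPmV_of_rank_eq`** (`Sign H_t(q) = genPmV (1 :: [det H_0(q), …, det H_t(q)])`
  when `det H_{r'}(q) ≠ 0`, `rank H_t(q) = r' + 1`).
* §816 BPR PROP. 9.25 a): **`sigPos_sub_sigNeg_hankelSq_dualSeq_eq_genPmV`** (`Sign H_t(Q/P) = genPmV(1 :: minors)` for `P` monic, `deg P ≤ t + 1`, `IsCoprime P Q`),
  **`genPmV_hankelSq_dualSeq_eq_cauchyIndex`** (over `ℝ`: `= Ind(Q/P)`), **`card_roots_toFinset_eq_genPmV`** (Hermite–Frobenius: `#` distinct real roots of a separable `P` = `genPmV` of the minors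
  of `H(P′/P)`).
CAVEATS.  Waits for the definition file N170 (review lane); the rank must be CARRIED by the leading block (`D_{rank} ≠ 0`).  Nothing Ext-side.  New names only.
-/

open Module Polynomial
open scoped Matrix Polynomial

namespace Summit.Ventures.HSemireg.Wedge.HankelOuter

open Summit.Ventures.HSemireg.Wedge Summit.Ventures.HSemireg.Wedge.Hankel
open Literature.Algebra.Polynomial (cauchyIndex)

/-! ## §815b. Frobenius for SINGULAR Hankel forms with `D_{rank} ≠ 0`: `Sign H_t(s) = PmV(1, det H_0(s), …, det H_t(s))` -/

section HankelRankPmV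

variable {K : Type*} [Field K] [LinearOrder K] [IsStrictOrderedRing K]

omit [IsStrictOrderedRing K] in
/-- Trailing zeros do not change `PmV`. [this file, §815] -/
theorem genPmVAux_append_replicate_zero (a : K) (g : ℕ) (l : List K) (c : ℕ) : genPmVAux K a g (l ++ List.replicate c 0) = genPmVAux K a g l := by
  induction l generalizing a g with
  | nil =>
    rw [List.nil_append, genPmVAux_nil]
    induction c generalizing g with
    | zero => rfl
    | succ c ih => rw [List.replicate_succ, genPmVAux_cons, if_pos rfl, ih]
  | cons b l ih => rw [List.cons_append, genPmVAux_cons, genPmVAux_cons, ih, ih]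

/-- **FROBENIUS ∕ BPR PROP. 9.25 a) IN HANKEL-MINOR FORM: if `det H_{r'}(q) ≠ 0` and `rank H_t(q) = r' + 1` (`r' ≤ t`), then `Sign H_t(q) = PmV(1, det H_0(q), …, det H_t(q))`** — the minors of
order `> r' + 1` vanish (rank) and are trailing zeros of the PmV count, and the head `PmV(1, det H_0, …, det H_{r'})` is `Sign H_{r'}(q) = Sign H_t(q)` (N170 + §814). For `q = dualSeq P Q` with
`P`, `Q` coprime, `deg P = r' + 1 ≤ t + 1` this is BPR's `Sign(Han(s̄_n)) = PmV(han(s̄_{[0..n]}))` (Prop. 9.25 a), first equality). [this file, §815] -/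
theorem sigPos_sub_sigNeg_hankelSq_eq_genPmV_of_rank_eq {t r' : ℕ} (hr : r' ≤ t) (q : ℕ → K) (hdet : (hankelSq K r' q).det ≠ 0) (hrank : (hankelSq K t q).rank = r' + 1) :
    (sigPos (hankelSq K t q).toQuadraticForm' : ℤ) - sigNeg (hankelSq K t q).toQuadraticForm' = genPmV K (1 :: (List.range (t + 1)).map fun k => (hankelSq K k q).det) := by
  obtain ⟨hp, hn⟩ := sigPos_sigNeg_hankelSq_eq_of_rank_eq hr q hdet hrank
  have htail : ((List.range (t - r')).map ((fun k => (hankelSq K k q).det) ∘ fun k => r' + 1 + k)) = List.replicate (t - r') 0 :=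
    List.eq_replicate_iff.2 ⟨by rw [List.length_map, List.length_range], fun b hb => by
      obtain ⟨k, hk, rfl⟩ := List.mem_map.1 hb
      have := List.mem_range.1 hk
      show (hankelSq K (r' + 1 + k) q).det = 0
      exact det_hankelSq_eq_zero_of_rank_le (t := t) (by omega) q (by rw [hrank]; omega)⟩
  have hlist : ((List.range (t + 1)).map fun k => (hankelSq K k q).det) = ((List.range (r' + 1)).map fun k => (hankelSq K k q).det) ++ List.replicate (t - r') 0 := by
    rw [show t + 1 = (r' + 1) + (t - r') by omega, List.range_add, List.map_append, List.map_map, htail]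
  rw [hp, hn, sigPos_sub_sigNeg_hankelSq_eq_genPmV r' q hdet, hlist, genPmV_cons, genPmV_cons, genPmVAux_append_replicate_zero]

end HankelRankPmV

/-! ## §816. BPR Proposition 9.25 a) for the digits of `Q/P`: `Sign H_t(Q/P) = PmV(1, han_1, …, han_{t+1})` (= `Ind(Q/P)` over `ℝ`, N152) for `P`, `Q` coprime, `deg P ≤ t + 1` -/

section BPR925

variable {K : Type*} [Field K] [LinearOrder K] [IsStrictOrderedRing K]

/-- **BPR PROP. 9.25 a), first equality: `Sign H_t(Q/P) = PmV(1, det H_0(Q/P), …, det H_t(Q/P))`** for `P` monic of degree `e + 1 ≤ t + 1` and `Q` coprime to `P` (the rank `e + 1` of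
`H_t(Q/P)` is carried by `det H_e(Q/P) = ±N(Q) ≠ 0`, N73 ∕ N142; then §815). [this file, §816] -/
theorem sigPos_sub_sigNeg_hankelSq_dualSeq_eq_genPmV [DecidableEq K] {e t : ℕ} {P : K[X]} (hP : P.Monic) (hPd : P.natDegree = e + 1) (het : e ≤ t) {Q : K[X]} (hc : IsCoprime P Q) :
    (sigPos (hankelSq K t (dualSeq K P Q)).toQuadraticForm' : ℤ) - sigNeg (hankelSq K t (dualSeq K P Q)).toQuadraticForm'
      = genPmV K (1 :: (List.range (t + 1)).map fun k => (hankelSq K k (dualSeq K P Q)).det) :=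
  sigPos_sub_sigNeg_hankelSq_eq_genPmV_of_rank_eq het _ ((det_hankelSq_dualSeq_ne_zero_iff K hP hPd Q).2 hc)
    ((rank_hankelSq_dualSeq_eq_natDegree_iff_isCoprime_of_le K hP hPd (by omega) Q).2 hc)

/-- **BPR PROP. 9.25 a) over `ℝ`: `PmV(1, det H_0(Q/P), …, det H_t(Q/P)) = Ind(Q/P)`** for `P` monic of degree `≤ t + 1`, `Q` coprime to `P`, all roots of `P` in `(lo, hi)` (§816 + N152's
`Sign H_t(Q/P) = Ind(Q/P)`). [this file, §816] -/
theorem genPmV_hankelSq_dualSeq_eq_cauchyIndex {e t : ℕ} {P : ℝ[X]} (hP : P.Monic) (hPd : P.natDegree = e + 1) (het : e ≤ t) {Q : ℝ[X]} (hc : IsCoprime P Q) {lo hi : ℝ}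
    (hroots : ∀ x ∈ P.roots, lo < x ∧ x < hi) :
    genPmV ℝ (1 :: (List.range (t + 1)).map fun k => (hankelSq ℝ k (dualSeq ℝ P Q)).det) = cauchyIndex P Q lo hi := by
  rw [← sigPos_sub_sigNeg_hankelSq_dualSeq_eq_genPmV hP hPd het hc, sigPos_sub_sigNeg_hankelSq_dualSeq_eq_cauchyIndex_of_monic hP hPd (by omega) Q hroots]

/-- **Hermite's real-root count by Frobenius' rule (BPR Remark 9.27 c) «This generalizes Remark 4.59»): for `P ∈ ℝ[X]` monic SEPARABLE of degree `≤ t + 1`, the number of distinct real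
roots of `P` is `PmV(1, det H_0(P′/P), …, det H_t(P′/P))`** — the signs of the leading minors of Hermite's Hankel form, zeros included (§816 with `Q = P′` + N129). [this file, §816] -/
theorem card_roots_toFinset_eq_genPmV {e t : ℕ} {P : ℝ[X]} (hP : P.Monic) (hPd : P.natDegree = e + 1) (het : e ≤ t) (hsep : P.Separable) :
    (P.roots.toFinset.card : ℤ) = genPmV ℝ (1 :: (List.range (t + 1)).map fun k => (hankelSq ℝ k (dualSeq ℝ P (derivative P))).det) := by
  rw [← sigPos_sub_sigNeg_hankelSq_dualSeq_derivative_real (t := t) hP (by omega), sigPos_sub_sigNeg_hankelSq_dualSeq_eq_genPmV hP hPd het ((Polynomial.separable_def _).1 hsep)]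

end BPR925

end Summit.Ventures.HSemireg.Wedge.HankelOuter
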